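import Summits.HubbardSuperconductivity.HubbardSuperconductivity.Theorems.AnisotropyChordStiffnessFarFieldSplit
import Literature.MathematicalPhysics.QuantumLattice.LiebRobinsonBoundProofs
import Mathlib.Analysis.SpecialFunctions.ImproperIntegrals

/-!
# Route `AnisotropyChord` / H0 rotor rung: K2 ingredients — operator norms, the Laplace lemma K2-L PROVED, and hard-core
# bosons as a finite-range `Interaction` (theory seat memo ROTOR-THEORY-8 §123; Sketch8 Parts V, Z, AA ported)

* `norm_siteSpin_le'` (`‖S^γ_x‖ ≤ n/2`), `norm_bondCurrent_le` (`‖j_{xy}‖ ≤ 1`);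
* `laplace_sin_eq`, `lorentz_sum_eq_integral`, **`laplaceSinLemma_holds : LaplaceSinLemma`**;
* `bondTerm`, `edgeSupport`, `hcbInteraction` with `localHamiltonian_hcbInteraction` (`Σ_Z Φ_Z = H`), `hcbInteraction_isLocal`,
  `hcbInteraction_card_le`, `hcbInteraction_eq_zero_of_not_edge`.
Typing/proof authority: theory seat `hubbard-h0-rotor-theory-1`, cycle 8 (ported verbatim up to namespaces).
-/


set_option linter.dupNamespace false

noncomputable section

open Matrix Complex Finset Filter Topology MeasureTheory
open scoped ComplexConjugate Matrix.Norms.L2Operator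
open Literature.MathematicalPhysics.QuantumLattice hiding torusPhase torusNorm
open Literature.Probability.LatticeModels
open Summit.HubbardSuperconductivity.HubbardSuperconductivity.Theorems.AnisotropyChord.InsertionEntropy

namespace Summit.HubbardSuperconductivity.HubbardSuperconductivity.Theorems.AnisotropyChord.Stiffness

/-! ## (port of Sketch8 section Norms) -/


open scoped MatrixOrder ComplexOrder in
/-- `‖S^γ_x‖ ≤ n/2` (L²-operator norm; the tree's argument in `XYStabilityTransfer`, which is private there):
`0 ≤ (S^γ_x)² ≤ (n/2)²·1` in the Loewner order and `‖TᴴT‖ = ‖T‖²`. -/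
theorem norm_siteSpin_le' {Λ : Type*} [Fintype Λ] [DecidableEq Λ] (n : ℕ) (x : Λ) (γ : Fin 3) :
    ‖(siteSpin n x γ : Op Λ (n + 1))‖ ≤ (n : ℝ) / 2 := by
  letI : CStarAlgebra (Op Λ (n + 1)) := {}
  have hH : (siteSpin n x γ : Op Λ (n + 1))ᴴ = siteSpin n x γ := (siteSpin_isHermitian n x γ).eq
  have h0 : (0 : Op Λ (n + 1)) ≤ siteSpin n x γ * siteSpin n x γ := by
    rw [Matrix.nonneg_iff_posSemidef]
    nth_rewrite 1 [← hH]
    exact Matrix.posSemidef_conjTranspose_mul_self _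
  have h1 : (siteSpin n x γ : Op Λ (n + 1)) * siteSpin n x γ ≤ (((n : ℂ) / 2) ^ 2) • (1 : Op Λ (n + 1)) := by
    rw [Matrix.le_iff]
    exact posSemidef_sq_smul_one_sub_siteSpin_sq n x γ
  have h2 : ‖(siteSpin n x γ : Op Λ (n + 1)) * siteSpin n x γ‖ ≤ ‖(((n : ℂ) / 2) ^ 2) • (1 : Op Λ (n + 1))‖ :=
    CStarAlgebra.norm_le_norm_of_nonneg_of_le h0 h1
  have h3 : ‖(siteSpin n x γ : Op Λ (n + 1)) * siteSpin n x γ‖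
      = ‖(siteSpin n x γ : Op Λ (n + 1))‖ * ‖(siteSpin n x γ : Op Λ (n + 1))‖ := by
    nth_rewrite 1 [← hH]
    exact Matrix.l2_opNorm_conjTranspose_mul_self _
  have h4 : ‖(((n : ℂ) / 2) ^ 2) • (1 : Op Λ (n + 1))‖ = ((n : ℝ) / 2) ^ 2 := by
    rw [norm_smul, CStarRing.norm_one, mul_one,
      show ((n : ℂ) / 2) ^ 2 = ((((n : ℝ) / 2) ^ 2 : ℝ) : ℂ) by push_cast; ring, Complex.norm_real,
      Real.norm_of_nonneg (by positivity)]
  rw [h3, h4] at h2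
  have h5 : ‖(siteSpin n x γ : Op Λ (n + 1))‖ * ‖(siteSpin n x γ : Op Λ (n + 1))‖ ≤ (n : ℝ) / 2 * ((n : ℝ) / 2) := by
    simpa [sq] using h2
  exact (mul_self_le_mul_self_iff (norm_nonneg _) (by positivity)).mpr h5

/-- `‖j_{xy}‖ ≤ 1` (indeed `≤ ½`). -/
theorem norm_bondCurrent_le (L : ℕ) [NeZero L] (x y : TorusSite 2 L) : ‖bondCurrent L x y‖ ≤ 1 := by
  unfold bondCurrent
  have h : ∀ (z : TorusSite 2 L) (γ : Fin 3), ‖(siteSpin 1 z γ : Op (TorusSite 2 L) 2)‖ ≤ 1 / 2 := by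
    intro z γ
    have := norm_siteSpin_le' (Λ := TorusSite 2 L) 1 z γ
    norm_num at this
    linarith
  have hn : ∀ (z : TorusSite 2 L) (γ : Fin 3), 0 ≤ ‖(siteSpin 1 z γ : Op (TorusSite 2 L) 2)‖ :=
    fun z γ => norm_nonneg _
  calc ‖(-Complex.I) • ((siteSpin 1 x 0 : Op (TorusSite 2 L) 2) * siteSpin 1 y 1
          - siteSpin 1 x 1 * siteSpin 1 y 0)‖
      = ‖(siteSpin 1 x 0 : Op (TorusSite 2 L) 2) * siteSpin 1 y 1 - siteSpin 1 x 1 * siteSpin 1 y 0‖ := by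
        rw [norm_smul]; simp
    _ ≤ ‖(siteSpin 1 x 0 : Op (TorusSite 2 L) 2) * siteSpin 1 y 1‖
          + ‖(siteSpin 1 x 1 : Op (TorusSite 2 L) 2) * siteSpin 1 y 0‖ := norm_sub_le _ _
    _ ≤ ‖(siteSpin 1 x 0 : Op (TorusSite 2 L) 2)‖ * ‖(siteSpin 1 y 1 : Op (TorusSite 2 L) 2)‖
          + ‖(siteSpin 1 x 1 : Op (TorusSite 2 L) 2)‖ * ‖(siteSpin 1 y 0 : Op (TorusSite 2 L) 2)‖ :=
        add_le_add (norm_mul_le _ _) (norm_mul_le _ _)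
    _ ≤ 1 / 2 * (1 / 2) + 1 / 2 * (1 / 2) :=
        add_le_add (mul_le_mul (h x 0) (h y 1) (hn y 1) (by norm_num))
          (mul_le_mul (h x 1) (h y 0) (hn y 0) (by norm_num))
    _ ≤ 1 := by norm_num


/-! ## (port of Sketch8 section Laplace) -/


/-- `∫₀^∞ e^{-Ωt} sin(ωt) dt = ω/(ω²+Ω²)`. -/
theorem laplace_sin_eq (Ω ω : ℝ) (hΩ : 0 < Ω) :
    ∫ t in Set.Ioi (0:ℝ), Real.exp (-Ω * t) * Real.sin (ω * t) = lorentzFilter Ω ω := by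
  have ha : ((-Ω : ℂ) + ω * Complex.I).re < 0 := by simp [hΩ]
  have hre : ∀ t : ℝ, (((-Ω : ℂ) + ω * Complex.I) * (t : ℂ)).re = -Ω * t := by
    intro t; simp [Complex.mul_re]
  have him : ∀ t : ℝ, (((-Ω : ℂ) + ω * Complex.I) * (t : ℂ)).im = ω * t := by
    intro t; simp [Complex.mul_im]
  have hpt : ∀ t : ℝ, Real.exp (-Ω * t) * Real.sin (ω * t)
      = RCLike.im (Complex.exp (((-Ω : ℂ) + ω * Complex.I) * (t : ℂ))) := by
    intro t
    rw [RCLike.im_to_complex, Complex.exp_im, hre, him]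
  simp_rw [hpt]
  rw [integral_im (integrableOn_exp_mul_complex_Ioi ha 0), integral_exp_mul_complex_Ioi ha 0,
    RCLike.im_to_complex]
  simp only [Complex.ofReal_zero, mul_zero, Complex.exp_zero]
  have hne : (ω ^ 2 + Ω ^ 2 : ℝ) ≠ 0 := by positivity
  rw [Complex.div_im]
  simp [Complex.normSq_apply]
  unfold lorentzFilter
  field_simp
  ring

/-- `Σ_i ℓ_Ω(ω_i) r_i = ∫₀^∞ e^{-Ωt} Σ_i r_i sin(ω_i t) dt`. -/
theorem lorentz_sum_eq_integral {ι : Type} [Fintype ι] (ω r : ι → ℝ) (Ω : ℝ) (hΩ : 0 < Ω) :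
    ∑ i, lorentzFilter Ω (ω i) * r i
      = ∫ t in Set.Ioi (0:ℝ), Real.exp (-Ω * t) * ∑ i, r i * Real.sin (ω i * t) := by
  have hexp : IntegrableOn (fun t : ℝ => Real.exp (-Ω * t)) (Set.Ioi 0) :=
    integrableOn_exp_mul_Ioi (neg_lt_zero.mpr hΩ) 0
  have hint : ∀ i, Integrable (fun t : ℝ => r i * (Real.exp (-Ω * t) * Real.sin (ω i * t)))
      (volume.restrict (Set.Ioi 0)) := by
    intro i
    have hg : Integrable (fun t : ℝ => |r i| * Real.exp (-Ω * t)) (volume.restrict (Set.Ioi 0)) :=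
      hexp.const_mul |r i|
    refine hg.mono'
      ((by fun_prop : Continuous (fun t : ℝ => r i * (Real.exp (-Ω * t) * Real.sin (ω i * t)))).aestronglyMeasurable)
      (ae_of_all _ fun t => ?_)
    rw [Real.norm_eq_abs, abs_mul, abs_mul, Real.abs_exp]
    exact mul_le_mul_of_nonneg_left
      (mul_le_of_le_one_right (Real.exp_pos _).le (Real.abs_sin_le_one _)) (abs_nonneg _)
  calc ∑ i, lorentzFilter Ω (ω i) * r i
      = ∑ i, ∫ t in Set.Ioi (0:ℝ), r i * (Real.exp (-Ω * t) * Real.sin (ω i * t)) := by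
        refine Finset.sum_congr rfl fun i _ => ?_
        rw [integral_const_mul, laplace_sin_eq Ω (ω i) hΩ, mul_comm]
    _ = ∫ t in Set.Ioi (0:ℝ), ∑ i, r i * (Real.exp (-Ω * t) * Real.sin (ω i * t)) :=
        (integral_finsetSum _ fun i _ => hint i).symm
    _ = _ := by
        congr 1; funext t; rw [Finset.mul_sum]
        exact Finset.sum_congr rfl fun i _ => by ring

/-- **K2-L PROVED.** -/
theorem laplaceSinLemma_holds : LaplaceSinLemma := by
  intro ι _ ω r Ω hΩ B₀ C₀ A v₀ hB₀ hC₀ hv₀ hS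
  rw [lorentz_sum_eq_integral ω r Ω hΩ]
  have hexp : IntegrableOn (fun t : ℝ => Real.exp (-Ω * t)) (Set.Ioi 0) :=
    integrableOn_exp_mul_Ioi (neg_lt_zero.mpr hΩ) 0
  -- pointwise majorant
  have key : ∀ t : ℝ, 0 < t → ‖Real.exp (-Ω * t) * ∑ i, r i * Real.sin (ω i * t)‖
      ≤ (Set.Ioi (A / (2 * v₀))).indicator (fun t => B₀ * Real.exp (-Ω * t)) t
        + C₀ * Real.exp (-(A / 2)) * Real.exp (-Ω * t) := by
    intro t ht
    have hSt := hS t ht.le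
    rw [Real.norm_eq_abs, abs_mul, Real.abs_exp]
    by_cases hT : A / (2 * v₀) < t
    · rw [Set.indicator_of_mem (show t ∈ Set.Ioi (A / (2 * v₀)) from hT)]
      have h1 : |∑ i, r i * Real.sin (ω i * t)| ≤ B₀ := hSt.trans (min_le_left _ _)
      have h2 : 0 ≤ C₀ * Real.exp (-(A / 2)) * Real.exp (-Ω * t) := by positivity
      nlinarith [Real.exp_pos (-Ω * t), abs_nonneg (∑ i, r i * Real.sin (ω i * t))]
    · rw [Set.indicator_of_notMem (show t ∉ Set.Ioi (A / (2 * v₀)) from hT), zero_add]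
      have h1 : |∑ i, r i * Real.sin (ω i * t)| ≤ C₀ * Real.exp (-A + v₀ * t) :=
        hSt.trans (min_le_right _ _)
      have ht' : t ≤ A / (2 * v₀) := not_lt.mp hT
      have h3 : Real.exp (-A + v₀ * t) ≤ Real.exp (-(A / 2)) := by
        refine Real.exp_le_exp.mpr ?_
        have : v₀ * t ≤ v₀ * (A / (2 * v₀)) := mul_le_mul_of_nonneg_left ht' hv₀.le
        have h4 : v₀ * (A / (2 * v₀)) = A / 2 := by field_simp
        linarith
      calc Real.exp (-Ω * t) * |∑ i, r i * Real.sin (ω i * t)|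
          ≤ Real.exp (-Ω * t) * (C₀ * Real.exp (-A + v₀ * t)) :=
            mul_le_mul_of_nonneg_left h1 (Real.exp_pos _).le
        _ ≤ Real.exp (-Ω * t) * (C₀ * Real.exp (-(A / 2))) := by gcongr
        _ = _ := by ring
  have hgi1 : Integrable (fun t : ℝ => (Set.Ioi (A / (2 * v₀))).indicator
      (fun t => B₀ * Real.exp (-Ω * t)) t) (volume.restrict (Set.Ioi 0)) :=
    (hexp.const_mul B₀).indicator measurableSet_Ioi
  have hgi2 : Integrable (fun t : ℝ => C₀ * Real.exp (-(A / 2)) * Real.exp (-Ω * t))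
      (volume.restrict (Set.Ioi 0)) := hexp.const_mul _
  have hgi : Integrable (fun t : ℝ => (Set.Ioi (A / (2 * v₀))).indicator
      (fun t => B₀ * Real.exp (-Ω * t)) t + C₀ * Real.exp (-(A / 2)) * Real.exp (-Ω * t))
      (volume.restrict (Set.Ioi 0)) := hgi1.add hgi2
  have hbound := norm_integral_le_of_norm_le hgi
    ((ae_restrict_iff' measurableSet_Ioi).mpr (ae_of_all _ fun t ht => key t ht))
  rw [Real.norm_eq_abs] at hbound
  refine hbound.trans ?_
  rw [integral_add hgi1 hgi2, integral_indicator measurableSet_Ioi,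
    Measure.restrict_restrict measurableSet_Ioi, Set.Ioi_inter_Ioi, integral_const_mul,
    integral_const_mul, integral_exp_mul_Ioi (neg_lt_zero.mpr hΩ),
    integral_exp_mul_Ioi (neg_lt_zero.mpr hΩ), neg_div_neg_eq, neg_div_neg_eq, mul_zero,
    Real.exp_zero]
  have hm : Real.exp (-Ω * (A / (2 * v₀) ⊔ 0)) ≤ Real.exp (-(Ω * A / (2 * v₀))) := by
    rw [show -(Ω * A / (2 * v₀)) = -Ω * (A / (2 * v₀)) by ring]
    exact Real.exp_le_exp.mpr (mul_le_mul_of_nonpos_left (le_max_left _ _) (by linarith))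
  calc B₀ * (Real.exp (-Ω * (A / (2 * v₀) ⊔ 0)) / Ω) + C₀ * Real.exp (-(A / 2)) * (1 / Ω)
      ≤ B₀ * (Real.exp (-(Ω * A / (2 * v₀))) / Ω) + C₀ * Real.exp (-(A / 2)) * (1 / Ω) := by
        gcongr
    _ = _ := by ring


/-! ## (port of Sketch8 section InteractionForm) -/


/-- The XXZ edge term `SˣSˣ + SʸSʸ + Δ SᶻSᶻ` on an unordered edge (the summand of `xxzHamiltonian`). -/
def bondTerm (L : ℕ) [NeZero L] (Δ : ℝ) (e : Sym2 (TorusSite 2 L)) : Op (TorusSite 2 L) 2 :=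
  Sym2.lift ⟨fun x y => spinBond 1 0 x y + spinBond 1 1 x y + (Δ : ℂ) • spinBond 1 2 x y,
    fun x y => by simp only [spinBond_comm]⟩ e

/-- The vertex set of an unordered pair as a `Finset`. -/
def edgeSupport (L : ℕ) [NeZero L] (e : Sym2 (TorusSite 2 L)) : Finset (TorusSite 2 L) :=
  Finset.univ.filter fun z => z ∈ e

/-- **I0.** Hard-core bosons as an `Interaction`: `Φ Z = -Σ_{e ∈ E(𝕋²_L), supp e = Z} h_e`. -/
def hcbInteraction (L : ℕ) [NeZero L] (Δ : ℝ) : Interaction (TorusSite 2 L) 2 :=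
  fun Z => ((-1 : ℝ) : ℂ) • ∑ e ∈ (torusGraph 2 L).edgeFinset with edgeSupport L e = Z, bondTerm L Δ e

/-- **I1 PROVED.** `H_{HCB} = Σ_{Z ⊆ Λ} Φ Z` (`localHamiltonian` of the HCB interaction). -/
theorem localHamiltonian_hcbInteraction (L : ℕ) [NeZero L] (Δ : ℝ) :
    localHamiltonian (hcbInteraction L Δ) Finset.univ = hcbHamiltonian L Δ := by
  unfold localHamiltonian hcbInteraction
  rw [← Finset.smul_sum,
    Finset.sum_fiberwise_of_maps_to (fun e _ => Finset.mem_powerset.mpr (Finset.subset_univ _))]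
  rfl

/-- `edgeSupport s(x,y) = {x, y}`. -/
theorem edgeSupport_mk (L : ℕ) [NeZero L] (x y : TorusSite 2 L) :
    edgeSupport L s(x, y) = {x, y} := by
  ext z; simp [edgeSupport]

/-- An edge has at most two endpoints. -/
theorem card_edgeSupport_le (L : ℕ) [NeZero L] (e : Sym2 (TorusSite 2 L)) :
    (edgeSupport L e).card ≤ 2 := by
  induction e using Sym2.ind with
  | h x y => rw [edgeSupport_mk]; exact Finset.card_le_two

/-- The bond term is supported on its edge. -/
theorem bondTerm_isSupportedOn (L : ℕ) [NeZero L] (Δ : ℝ) (e : Sym2 (TorusSite 2 L)) :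
    IsSupportedOn (bondTerm L Δ e) (edgeSupport L e) := by
  induction e using Sym2.ind with
  | h x y =>
    rw [edgeSupport_mk]
    have hx : ∀ α, IsSupportedOn (siteSpin 1 x α : Op (TorusSite 2 L) 2) ({x, y} : Finset _) :=
      fun α => IsSupportedOn.mono_holds (isSupportedOn_onSite_holds x _) (by simp)
    have hy : ∀ α, IsSupportedOn (siteSpin 1 y α : Op (TorusSite 2 L) 2) ({x, y} : Finset _) :=
      fun α => IsSupportedOn.mono_holds (isSupportedOn_onSite_holds y _) (by simp)
    have hb : ∀ α, IsSupportedOn (spinBond 1 α x y : Op (TorusSite 2 L) 2) ({x, y} : Finset _) := by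
      intro α; unfold spinBond
      exact ((IsSupportedOn.mul_holds (hx α) (hy α)).add (IsSupportedOn.mul_holds (hy α) (hx α))).smul _
    show IsSupportedOn (spinBond 1 0 x y + spinBond 1 1 x y + (Δ : ℂ) • spinBond 1 2 x y) _
    exact ((hb 0).add (hb 1)).add ((hb 2).smul _)

/-- **I2 PROVED.** The HCB interaction is local (each `Φ Z` supported on `Z` and Hermitian). -/
theorem hcbInteraction_isLocal (L : ℕ) [NeZero L] (Δ : ℝ) : (hcbInteraction L Δ).IsLocal := by
  intro Z
  constructor
  · unfold hcbInteraction
    refine IsSupportedOn.smul (IsSupportedOn.sum _ fun e he => ?_) _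
    rw [Finset.mem_filter] at he
    rw [← he.2]
    exact bondTerm_isSupportedOn L Δ e
  · unfold hcbInteraction
    refine Matrix.IsHermitian.smul ?_ ?_
    · rw [Matrix.IsHermitian, Matrix.conjTranspose_sum]
      exact Finset.sum_congr rfl fun e _ => (xxzEdgeTerm_isHermitian 1 Δ e).eq
    · rw [isSelfAdjoint_iff, Complex.star_def, Complex.conj_ofReal]

/-- **I3 PROVED.** Finite range: `Φ Z ≠ 0 → #Z ≤ 2` (and `Z` is then the support of an edge). -/
theorem hcbInteraction_card_le (L : ℕ) [NeZero L] (Δ : ℝ) (Z : Finset (TorusSite 2 L))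
    (hZ : hcbInteraction L Δ Z ≠ 0) : Z.card ≤ 2 := by
  by_contra h
  apply hZ
  unfold hcbInteraction
  rw [Finset.sum_eq_zero fun e he => ?_, smul_zero]
  rw [Finset.mem_filter] at he
  exact absurd (he.2 ▸ card_edgeSupport_le L e) h

/-- The interaction vanishes on non-edges. -/
theorem hcbInteraction_eq_zero_of_not_edge (L : ℕ) [NeZero L] (Δ : ℝ) (Z : Finset (TorusSite 2 L))
    (hZ : ∀ e ∈ (torusGraph 2 L).edgeFinset, edgeSupport L e ≠ Z) : hcbInteraction L Δ Z = 0 := by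
  unfold hcbInteraction
  rw [Finset.sum_eq_zero fun e he => ?_, smul_zero]
  rw [Finset.mem_filter] at he
  exact absurd he.2 (hZ e he.1)


end Summit.HubbardSuperconductivity.HubbardSuperconductivity.Theorems.AnisotropyChord.Stiffness
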